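import Summits.RiemannHypothesis.RiemannHypothesis.Theorems.SoninPolyEta
import Summits.RiemannHypothesis.RiemannHypothesis.Theorems.SemilocalSoninPolyWeilSide
import HarnessLib

/-!
# The twisted Sonin trace form of a polynomial section vector against a polynomial window, I: closed forms and folding

Cell `rh-explicit`, seat cc-s2-1 (sub-line (ii), S = {∞, 2}).  GENERIC form of cc-s2-3's P4-A/P4-B (`SoninCertBKappa`,
`SoninCertBSplit`, hard-wired to one window `gL·1_{[−b,b]}`, `b = 107/200`, and one vector on `[1, 8]`): for ANY
polynomial window `G = polyWitness p b` (cc-s2-4) and ANY polynomial section vector `η = polyEta r X` (`SoninPolyEta`),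
the real number the frame entry point needs a certified lower bound of,
`B = Re ⟨η | ϑ(T₂(G ⋆ G̃)) η⟩ = Re soninTraceForm (twistKernel 2 (G ⋆ G̃)) η`, is reduced to a ONE-DIMENSIONAL integral of
explicit elementary functions:
* the kernel `(G ⋆ G̃)(τ) = κ(|τ|)·1_{|τ| ≤ 2b}`, `κ = ev (kappaL p b)` (gen4's `weilConv_polyWitness_weilReflect_of_le/_of_lt`),
  packaged as the real function `kapG p b`;
* **the scaling coefficient in closed form**: for `0 ≤ s` and `e^s ≤ X`,
  `Re ⟨η | ϑ(e^s) η⟩ = cfun r X s := Σ_{i,j < |r|} (2 r_i r_j/(i+j+1))·(X^{i+j+1} e^{−(2j+1)s/2} − e^{(2i+1)s/2})`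
  (`⟨η|ϑ(e^s)η⟩ = e^{−s/2}∫ conj η(v) η(e^{−s}v) dv = 2e^{−s/2}∫_{e^s}^X R(v)R(e^{−s}v) dv`, expanded in monomials);
  evenness `c(−s) = c(s)` (unitarity), `|c| ≤ ‖η‖²`, continuity;
* **folding**: `B = ∫ ((3/2)κ_G(τ) − e^{−L/2}(κ_G(τ−L) + κ_G(τ+L))) c(τ) dτ = ∫₀^{2b} κ(u)(3c(u) − 2e^{−L/2}(c(u+L) + c(|u−L|))) du`,
  `L = log 2` (translation invariance + evenness of `κ_G` and `c`).
Parts II/III (`SoninPolyTraceSum`/`Bound`) insert the exponential sum and bound it.  Definitions: `kapG`, `cfun`, `cre`.  No facts, no axioms.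
-/

set_option linter.dupNamespace false  -- the mandated namespace repeats `RiemannHypothesis`

noncomputable section

open MeasureTheory Complex Set Finset
open scoped Real ComplexConjugate
open Summit.RiemannHypothesis.RiemannHypothesis.Theorems.SemilocalPolyWitness
open Summit.RiemannHypothesis.RiemannHypothesis.Theorems.MotivicDoor
open Summit.RiemannHypothesis.RiemannHypothesis.BandEnergy (getD_map_range)
open Literature.NumberTheory.LFunctions Literature.NumberTheory.ConnesConsani2021

namespace Summit.RiemannHypothesis.RiemannHypothesis.SoninPoly

/-! ## The kernel `κ_G` of a polynomial window -/

section Kernel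

variable (p : List ℚ) (b : ℚ)

/-- The real kernel `κ_G(u) = κ(|u|)·1_{|u| ≤ 2b}`, `κ = ev (kappaL p b)`. [folklore] -/
def kapG (u : ℝ) : ℝ := if |u| ≤ 2 * (b : ℝ) then LQ.ev (kappaL p b) |u| else 0

/-- `κ_G` vanishes for `|u| > 2b`. [folklore] -/
theorem kapG_eq_zero {u : ℝ} (hu : 2 * (b : ℝ) < |u|) : kapG p b u = 0 := by
  unfold kapG; rw [if_neg (not_le.2 hu)]

/-- On `|u| ≤ 2b`: `κ_G(u) = κ(|u|)`. [folklore] -/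
theorem kapG_of_abs_le {u : ℝ} (hu : |u| ≤ 2 * (b : ℝ)) : kapG p b u = LQ.ev (kappaL p b) |u| := by
  unfold kapG; rw [if_pos hu]

/-- `|κ_G(u)| ≤ absBound (kappaL p b) (2b)` (for `0 ≤ b`). [folklore] -/
theorem abs_kapG_le (hb : 0 ≤ b) (u : ℝ) : |kapG p b u| ≤ (LQ.absBound (kappaL p b) (2 * b) : ℝ) := by
  unfold kapG
  split_ifs with h
  · have h' : |(|u|)| ≤ ((2 * b : ℚ) : ℝ) := by rw [abs_abs]; push_cast; exact h
    exact LQ.abs_ev_le_absBound _ h'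
  · rw [abs_zero]; exact_mod_cast LQ.absBound_nonneg _ (by linarith)

/-- `κ_G` is measurable. [folklore] -/
theorem measurable_kapG : Measurable (kapG p b) := by
  unfold kapG
  refine Measurable.ite (measurableSet_le measurable_norm measurable_const) ?_ measurable_const
  exact ((LQ.continuous_ev _).comp continuous_abs).measurable

variable {p b}

/-- **The kernel in closed form**: `(G ⋆ G̃)(τ) = κ_G(τ)` for `G = polyWitness p b`. [folklore] -/
theorem weilConv_polyWitness_eq_kapG :
    weilConv (polyWitness p b) (weilReflect (polyWitness p b)) = fun τ => ((kapG p b τ : ℝ) : ℂ) := by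
  funext τ
  unfold kapG
  split_ifs with h
  · exact weilConv_polyWitness_weilReflect_of_le h
  · rw [weilConv_polyWitness_weilReflect_of_lt (not_le.1 h), Complex.ofReal_zero]

/-- `κ_G` is integrable (as a complex function), for `0 ≤ b`. [folklore] -/
theorem integrable_kapG_complex (hb : 0 ≤ b) : Integrable fun t => ((kapG p b t : ℝ) : ℂ) :=
  SemilocalMarkov.integrable_of_norm_le_of_eq_zero (C := (LQ.absBound (kappaL p b) (2 * b) : ℝ)) (R := 2 * b)
    (Complex.continuous_ofReal.measurable.comp (measurable_kapG p b)).aestronglyMeasurable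
    (fun t => by rw [Complex.norm_real, Real.norm_eq_abs]; exact abs_kapG_le p b hb t)
    (fun t ht => by rw [kapG_eq_zero p b (by exact_mod_cast ht), Complex.ofReal_zero])

end Kernel

/-! ## The scaling coefficient of `η_{r,X}` in closed form -/

section Scaling

variable (r : List ℚ) {X : ℚ}

/-- **The closed form** `cfun r X s = Σ_{i,j<|r|} (2 r_i r_j/(i+j+1))·(X^{i+j+1} e^{−(2j+1)s/2} − e^{(2i+1)s/2})`
of `Re ⟨η | ϑ(e^s) η⟩` (`0 ≤ s`, `e^s ≤ X`). [folklore] -/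
def cfun (X : ℚ) (s : ℝ) : ℝ :=
  ∑ i ∈ range r.length, ∑ j ∈ range r.length,
    ((2 * r.getD i 0 * r.getD j 0 / ((i : ℚ) + j + 1) : ℚ) : ℝ)
      * ((X : ℝ) ^ (i + j + 1) * Real.exp (-(2 * (j : ℝ) + 1) * s / 2) - Real.exp ((2 * (i : ℝ) + 1) * s / 2))

/-- `c(τ) := Re ⟨η | ϑ(e^τ) η⟩` for the class `polyEta r X`. [folklore] -/
def cre (hX0 : 0 ≤ X) (τ : ℝ) : ℝ := (scalingCoeff (polyEta r hX0 : ℝ → ℂ) (polyEta r hX0 : ℝ → ℂ) τ).re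

/-- On `a ≤ v ≤ X` (`1 ≤ a`): `conj η(v)·η(a⁻¹v) = R(v)R(a⁻¹v)`. [folklore] -/
theorem polyEtaFun_mul_dil_of_mem {a v : ℝ} (ha1 : 1 ≤ a) (hv : v ∈ Icc a X) :
    conj (polyEtaFun r X v) * polyEtaFun r X (a⁻¹ * v) = ((LQ.ev r v * LQ.ev r (a⁻¹ * v) : ℝ) : ℂ) := by
  have ha0 : 0 < a := by linarith
  have h1 : v ∈ Icc (1 : ℝ) X := ⟨by linarith [hv.1], hv.2⟩
  have h2 : a⁻¹ * v ∈ Icc (1 : ℝ) X := by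
    constructor
    · rw [le_inv_mul_iff₀ ha0]; linarith [hv.1]
    · rw [inv_mul_le_iff₀ ha0]
      have : (0 : ℝ) ≤ X := by linarith [hv.1, hv.2]
      nlinarith [hv.2]
  rw [polyEtaFun_of_mem r X h1, polyEtaFun_of_mem r X h2, Complex.conj_ofReal]; push_cast; ring

/-- The product `conj η(v)·η(a⁻¹v)` vanishes unless `a ≤ |v| ≤ X` (`0 < a`). [folklore] -/
theorem polyEtaFun_mul_dil_eq_zero {a v : ℝ} (ha0 : 0 < a) (h1 : v ∉ Icc a X) (h2 : v ∉ Icc (-(X : ℝ)) (-a)) :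
    conj (polyEtaFun r X v) * polyEtaFun r X (a⁻¹ * v) = 0 := by
  by_cases hX : v ∈ Icc (-(X : ℝ)) X
  · have hlt : |a⁻¹ * v| < 1 := by
      rw [abs_mul, abs_of_pos (inv_pos.2 ha0), inv_mul_lt_iff₀ ha0, mul_one, abs_lt]
      constructor
      · by_contra h; exact h2 ⟨hX.1, by linarith⟩
      · by_contra h; exact h1 ⟨by linarith, hX.2⟩
    rw [polyEtaFun_eq_zero_of_abs_lt r X hlt, mul_zero]
  · rw [polyEtaFun_eq_zero_of_not_mem r X hX, map_zero, zero_mul]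

/-- `∫ conj η(v) η(a⁻¹ v) dv = 2 ∫_a^X R(v) R(a⁻¹v) dv` for `1 ≤ a ≤ X`. [folklore] -/
theorem integral_conj_polyEtaFun_mul_dil {a : ℝ} (ha1 : 1 ≤ a) (haX : a ≤ X) :
    ∫ v, conj (polyEtaFun r X v) * polyEtaFun r X (a⁻¹ * v)
      = ((2 * ∫ v in a..X, LQ.ev r v * LQ.ev r (a⁻¹ * v) : ℝ) : ℂ) := by
  have ha0 : 0 < a := by linarith
  set f : ℝ → ℝ := fun v => LQ.ev r v * LQ.ev r (a⁻¹ * v) with hf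
  have hfc : Continuous f := (LQ.continuous_ev _).mul ((LQ.continuous_ev _).comp (continuous_const.mul continuous_id))
  have hsplit : (fun v => conj (polyEtaFun r X v) * polyEtaFun r X (a⁻¹ * v))
      = (Icc a X).indicator (fun v => ((f v : ℝ) : ℂ)) + (Icc (-(X : ℝ)) (-a)).indicator (fun v => ((f (-v) : ℝ) : ℂ)) := by
    funext v
    simp only [Pi.add_apply]
    by_cases h1 : v ∈ Icc a X
    · have h2 : v ∉ Icc (-(X : ℝ)) (-a) := fun h => by linarith [h.2, h1.1]
      rw [indicator_of_mem h1, indicator_of_notMem h2, add_zero, polyEtaFun_mul_dil_of_mem r ha1 h1]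
    · by_cases h2 : v ∈ Icc (-(X : ℝ)) (-a)
      · have h1' : -v ∈ Icc a X := ⟨by linarith [h2.2], by linarith [h2.1]⟩
        rw [indicator_of_notMem h1, indicator_of_mem h2, zero_add, ← polyEtaFun_neg r X v,
          ← polyEtaFun_neg r X (a⁻¹ * v), show -(a⁻¹ * v) = a⁻¹ * (-v) by ring,
          polyEtaFun_mul_dil_of_mem r ha1 h1']
      · rw [indicator_of_notMem h1, indicator_of_notMem h2, add_zero, polyEtaFun_mul_dil_eq_zero r ha0 h1 h2]
  have hc1 : Continuous fun v : ℝ => ((f v : ℝ) : ℂ) := Complex.continuous_ofReal.comp hfc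
  have hc2 : Continuous fun v : ℝ => ((f (-v) : ℝ) : ℂ) := Complex.continuous_ofReal.comp (hfc.comp continuous_neg)
  rw [hsplit, integral_add' (hc1.integrableOn_Icc.integrable_indicator measurableSet_Icc)
    (hc2.integrableOn_Icc.integrable_indicator measurableSet_Icc),
    integral_indicator measurableSet_Icc, integral_indicator measurableSet_Icc, integral_complex_ofReal,
    integral_complex_ofReal, integral_Icc_eq_integral_Ioc, ← intervalIntegral.integral_of_le haX,
    integral_Icc_eq_integral_Ioc, ← intervalIntegral.integral_of_le (by linarith : (-(X : ℝ)) ≤ -a),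
    intervalIntegral.integral_comp_neg (fun v => f v)]
  push_cast
  simp only [neg_neg]
  ring

/-- `2∫_a^X R(v) R(a⁻¹ v) dv = Σ_{i,j} (2 r_i r_j/(i+j+1)) · a^{−j} (X^{i+j+1} − a^{i+j+1})`. [folklore] -/
theorem intervalIntegral_ev_mul_ev_dil (a : ℝ) :
    2 * ∫ v in a..X, LQ.ev r v * LQ.ev r (a⁻¹ * v)
      = ∑ i ∈ range r.length, ∑ j ∈ range r.length,
          ((2 * r.getD i 0 * r.getD j 0 / ((i : ℚ) + j + 1) : ℚ) : ℝ)
            * ((a⁻¹) ^ j * ((X : ℝ) ^ (i + j + 1) - a ^ (i + j + 1))) := by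
  have e : (fun v => LQ.ev r v * LQ.ev r (a⁻¹ * v))
      = fun v => ∑ i ∈ range r.length, ∑ j ∈ range r.length,
          ((r.getD i 0 : ℝ) * (r.getD j 0 : ℝ) * (a⁻¹) ^ j) * v ^ (i + j) := by
    funext v
    rw [LQ.ev_eq_sum r v, LQ.ev_eq_sum r (a⁻¹ * v), Finset.sum_mul]
    refine Finset.sum_congr rfl fun i _ => ?_
    rw [Finset.mul_sum]
    refine Finset.sum_congr rfl fun j _ => ?_
    rw [mul_pow, pow_add]; ring
  have hIj : ∀ i ∈ range r.length, IntervalIntegrable (fun v : ℝ => ∑ j ∈ range r.length,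
      ((r.getD i 0 : ℝ) * (r.getD j 0 : ℝ) * (a⁻¹) ^ j) * v ^ (i + j)) volume a X := fun i _ =>
    (continuous_finsetSum _ fun j _ => continuous_const.mul (continuous_pow _)).intervalIntegrable _ _
  rw [e, intervalIntegral.integral_finsetSum hIj, Finset.mul_sum]
  refine Finset.sum_congr rfl fun i _ => ?_
  rw [intervalIntegral.integral_finsetSum (fun j _ =>
      (by fun_prop : Continuous fun x : ℝ => (r.getD i 0 : ℝ) * (r.getD j 0 : ℝ) * (a⁻¹) ^ j * x ^ (i + j)).intervalIntegrable _ _),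
    Finset.mul_sum]
  refine Finset.sum_congr rfl fun j _ => ?_
  rw [intervalIntegral.integral_const_mul, integral_pow]
  have hden : ((i : ℝ) + j + 1) ≠ 0 := by positivity
  push_cast
  field_simp

/-- **The scaling coefficient in closed form**: `Re ⟨η | ϑ(e^s) η⟩ = cfun r X s` for `0 ≤ s`, `e^s ≤ X`. [folklore] -/
theorem cre_eq_cfun (hX0 : 0 ≤ X) {s : ℝ} (hs0 : 0 ≤ s) (hsX : Real.exp s ≤ X) : cre r hX0 s = cfun r X s := by
  set a : ℝ := Real.exp s with ha
  have ha1 : 1 ≤ a := by rw [ha]; exact Real.one_le_exp hs0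
  have ha0 : 0 < a := by linarith
  have hexp : Real.exp (-s) = a⁻¹ := by rw [Real.exp_neg]
  have h1 := polyEta_coeFn r hX0
  have h2 : (fun v : ℝ => (polyEta r hX0 : ℝ → ℂ) (a⁻¹ * v)) =ᵐ[volume] fun v => polyEtaFun r X (a⁻¹ * v) :=
    (Literature.Analysis.OperatorTheory.quasiMeasurePreserving_smul' (V := ℝ) (inv_ne_zero ha0.ne')).ae_eq h1
  have hsc : scalingCoeff (polyEta r hX0 : ℝ → ℂ) (polyEta r hX0 : ℝ → ℂ) s
      = (Real.exp (-s / 2) : ℂ) * ∫ v, conj (polyEtaFun r X v) * polyEtaFun r X (a⁻¹ * v) := by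
    unfold scalingCoeff
    rw [← integral_const_mul]
    refine integral_congr_ae ?_
    filter_upwards [h1, h2] with v hv hv2
    rw [hv, hexp, hv2]; ring
  rw [cre, hsc, integral_conj_polyEtaFun_mul_dil r ha1 hsX, intervalIntegral_ev_mul_ev_dil r a,
    ← Complex.ofReal_mul, Complex.ofReal_re, cfun, Finset.mul_sum]
  refine Finset.sum_congr rfl fun i _ => ?_
  rw [Finset.mul_sum]
  refine Finset.sum_congr rfl fun j _ => ?_
  -- exponentials: `a⁻¹ ^ j = e^{-js}`, `a ^ n = e^{ns}`
  have haj : (a⁻¹) ^ j = Real.exp (-(j : ℝ) * s) := by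
    rw [← hexp, ← Real.exp_nat_mul]; ring_nf
  have han : a ^ (i + j + 1) = Real.exp (((i + j + 1 : ℕ) : ℝ) * s) := by
    rw [ha, ← Real.exp_nat_mul]
  have e1 : Real.exp (-s / 2) * Real.exp (-(j : ℝ) * s) = Real.exp (-(2 * (j : ℝ) + 1) * s / 2) := by
    rw [← Real.exp_add]; ring_nf
  have e2 : Real.exp (-s / 2) * Real.exp (-(j : ℝ) * s) * Real.exp (((i + j + 1 : ℕ) : ℝ) * s)
      = Real.exp ((2 * (i : ℝ) + 1) * s / 2) := by
    rw [← Real.exp_add, ← Real.exp_add]; push_cast; ring_nf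
  rw [haj, han]
  set q : ℝ := ((2 * r.getD i 0 * r.getD j 0 / ((i : ℚ) + j + 1) : ℚ) : ℝ)
  set E0 : ℝ := Real.exp (-s / 2)
  set E1 : ℝ := Real.exp (-(j : ℝ) * s)
  set E2 : ℝ := Real.exp (((i + j + 1 : ℕ) : ℝ) * s)
  set Y : ℝ := (X : ℝ) ^ (i + j + 1)
  calc E0 * (q * (E1 * (Y - E2))) = q * (Y * (E0 * E1) - E0 * E1 * E2) := by ring
    _ = q * (Y * Real.exp (-(2 * (j : ℝ) + 1) * s / 2) - Real.exp ((2 * (i : ℝ) + 1) * s / 2)) := by rw [e2, e1]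

/-- **Evenness**: `c(−s) = c(s)` (unitarity of `ϑ`). [folklore] -/
theorem cre_neg (hX0 : 0 ≤ X) (s : ℝ) : cre r hX0 (-s) = cre r hX0 s := by
  unfold cre; rw [scalingCoeff_neg, Complex.conj_re]

/-- `|c(τ)| ≤ ‖η‖²`. [folklore] -/
theorem abs_cre_le (hX0 : 0 ≤ X) (s : ℝ) : |cre r hX0 s| ≤ ‖polyEta r hX0‖ ^ 2 := by
  unfold cre
  refine (Complex.abs_re_le_norm _).trans ?_
  rw [sq]
  exact norm_scalingCoeff_le _ _ s

/-- `c` is continuous. [folklore] -/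
theorem continuous_cre (hX0 : 0 ≤ X) : Continuous (cre r hX0) :=
  Complex.continuous_re.comp (continuous_scalingCoeff _ _)

end Scaling

/-! ## Folding `B` onto `[0, 2b]` -/

section Fold

variable {p : List ℚ} {b : ℚ} (r : List ℚ) {X : ℚ}

/-- The real twisted kernel `(T₂ κ_G)(τ)`. [folklore] -/
theorem twistKernel_kapG (τ : ℝ) :
    twistKernel 2 (fun t => ((kapG p b t : ℝ) : ℂ)) τ
      = (((3 / 2) * kapG p b τ - Real.exp (-(Real.log 2 / 2)) * (kapG p b (τ - Real.log 2) + kapG p b (τ + Real.log 2)) : ℝ) : ℂ) := by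
  rw [twistKernel]; push_cast; ring

/-- **`B` as a real integral**:
`Re ⟨η | ϑ(T₂(G⋆G̃)) η⟩ = ∫ ((3/2)κ_G(τ) − e^{−L/2}(κ_G(τ−L) + κ_G(τ+L))) c(τ) dτ` (`0 ≤ b`). [folklore] -/
theorem re_soninTraceForm_eq_integral (hb : 0 ≤ b) (hX0 : 0 ≤ X) :
    (soninTraceForm (twistKernel 2 (weilConv (polyWitness p b) (weilReflect (polyWitness p b))))
        (polyEta r hX0 : ℝ → ℂ)).re
      = ∫ τ, ((3 / 2) * kapG p b τ - Real.exp (-(Real.log 2 / 2)) * (kapG p b (τ - Real.log 2) + kapG p b (τ + Real.log 2)))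
          * cre r hX0 τ := by
  rw [weilConv_polyWitness_eq_kapG, soninTraceForm]
  have hint := integrable_mul_scalingCoeff
    (integrable_twistKernel 2 (integrable_kapG_complex (p := p) hb)) (polyEta r hX0) (polyEta r hX0)
  rw [← RCLike.re_to_complex, ← integral_re hint]
  refine integral_congr_ae (Filter.Eventually.of_forall fun τ => ?_)
  simp only [twistKernel_kapG, RCLike.re_to_complex, Complex.re_ofReal_mul, cre]

/-- `τ ↦ κ_G(τ + c)·h(τ)` is integrable for bounded continuous `h` (`0 ≤ b`). [folklore] -/
theorem integrable_kapG_shift_mul (hb : 0 ≤ b) {h : ℝ → ℝ} (hc : Continuous h) {M : ℝ} (hM : ∀ τ, |h τ| ≤ M) (c : ℝ) :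
    Integrable fun τ => kapG p b (τ + c) * h τ := by
  refine SemilocalMarkov.integrable_of_norm_le_of_eq_zero (C := (LQ.absBound (kappaL p b) (2 * b) : ℝ) * M)
    (R := 2 * b + |c|) ((((measurable_kapG p b).comp (measurable_id.add_const c)).mul hc.measurable).aestronglyMeasurable)
    (fun τ => ?_) (fun τ hτ => ?_)
  · rw [norm_mul, Real.norm_eq_abs, Real.norm_eq_abs]
    exact mul_le_mul (abs_kapG_le p b hb _) (hM τ) (abs_nonneg _)
      (by exact_mod_cast LQ.absBound_nonneg (kappaL p b) (by linarith))
  · rw [kapG_eq_zero p b, zero_mul]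
    calc 2 * (b : ℝ) < |τ| - |c| := by linarith
      _ ≤ |τ + c| := by
          have := abs_add_le (τ + c) (-c)
          rw [add_neg_cancel_right, abs_neg] at this
          linarith

/-- **Folding lemma**: `∫ κ_G(u) h(u) du = ∫_0^{2b} κ(u)(h(u) + h(−u)) du` for continuous `h` (`0 ≤ b`). [folklore] -/
theorem integral_kapG_mul (hb : 0 ≤ b) (h : ℝ → ℝ) (hc : Continuous h) :
    ∫ u, kapG p b u * h u = ∫ u in (0 : ℝ)..(2 * b), LQ.ev (kappaL p b) u * (h u + h (-u)) := by
  have hb' : (0 : ℝ) ≤ 2 * b := by exact_mod_cast (by linarith : (0 : ℚ) ≤ 2 * b)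
  rw [← setIntegral_eq_integral_of_forall_compl_eq_zero (s := Icc (-(2 * (b : ℝ))) (2 * b)) (fun u hu => by
    rw [kapG_eq_zero p b (SemilocalMarkov.lt_abs_of_not_mem_Icc hu), zero_mul])]
  rw [setIntegral_congr_fun measurableSet_Icc (fun u hu => by simp only [kapG_of_abs_le p b (abs_le.2 hu)] :
      EqOn (fun u => kapG p b u * h u) (fun u => LQ.ev (kappaL p b) |u| * h u) (Icc (-(2 * (b : ℝ))) (2 * b))),
    integral_Icc_eq_integral_Ioc, ← intervalIntegral.integral_of_le (by linarith)]
  have hf : Continuous fun u => LQ.ev (kappaL p b) |u| * h u := ((LQ.continuous_ev _).comp continuous_abs).mul hc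
  rw [← intervalIntegral.integral_add_adjacent_intervals (b := 0) (hf.intervalIntegrable _ _) (hf.intervalIntegrable _ _)]
  have hneg : ∫ u in (-(2 * (b : ℝ)))..0, LQ.ev (kappaL p b) |u| * h u
      = ∫ u in (0 : ℝ)..(2 * b), LQ.ev (kappaL p b) |u| * h (-u) := by
    rw [← neg_zero, ← intervalIntegral.integral_comp_neg (fun u => LQ.ev (kappaL p b) |u| * h u), neg_zero]
    simp only [abs_neg]
  have hf' : Continuous fun u => LQ.ev (kappaL p b) |u| * h (-u) :=
    ((LQ.continuous_ev _).comp continuous_abs).mul (hc.comp continuous_neg)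
  rw [hneg, ← intervalIntegral.integral_add (hf'.intervalIntegrable _ _) (hf.intervalIntegrable _ _)]
  refine intervalIntegral.integral_congr fun u hu => ?_
  rw [uIcc_of_le hb'] at hu
  rw [abs_of_nonneg hu.1]
  ring

/-- **`B` folded onto `[0, 2b]`**:
`B = ∫_0^{2b} κ(u)(3c(u) − 2e^{−L/2}(c(u+L) + c(|u−L|))) du` (`0 ≤ b`). [folklore] -/
theorem re_soninTraceForm_eq_fold (hb : 0 ≤ b) (hX0 : 0 ≤ X) :
    (soninTraceForm (twistKernel 2 (weilConv (polyWitness p b) (weilReflect (polyWitness p b))))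
        (polyEta r hX0 : ℝ → ℂ)).re
      = ∫ u in (0 : ℝ)..(2 * b), LQ.ev (kappaL p b) u *
          (3 * cre r hX0 u - 2 * Real.exp (-(Real.log 2 / 2)) * (cre r hX0 (u + Real.log 2) + cre r hX0 |u - Real.log 2|)) := by
  have hcc : Continuous (cre r hX0) := continuous_cre r hX0
  have hM : ∀ τ, |cre r hX0 τ| ≤ ‖polyEta r hX0‖ ^ 2 := abs_cre_le r hX0
  have i0 : Integrable fun τ => kapG p b τ * cre r hX0 τ := by
    simpa using integrable_kapG_shift_mul (p := p) hb hcc hM 0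
  have i1 : Integrable fun τ => kapG p b (τ - Real.log 2) * cre r hX0 τ := by
    simpa [sub_eq_add_neg] using integrable_kapG_shift_mul (p := p) hb hcc hM (-Real.log 2)
  have i2 : Integrable fun τ => kapG p b (τ + Real.log 2) * cre r hX0 τ := integrable_kapG_shift_mul hb hcc hM (Real.log 2)
  rw [re_soninTraceForm_eq_integral r hb hX0]
  have e : ∀ τ, ((3 / 2) * kapG p b τ - Real.exp (-(Real.log 2 / 2)) * (kapG p b (τ - Real.log 2) + kapG p b (τ + Real.log 2)))
        * cre r hX0 τ
      = (3 / 2) * (kapG p b τ * cre r hX0 τ) - Real.exp (-(Real.log 2 / 2)) *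
          (kapG p b (τ - Real.log 2) * cre r hX0 τ + kapG p b (τ + Real.log 2) * cre r hX0 τ) := fun τ => by ring
  simp_rw [e]
  have i12 : Integrable fun τ => kapG p b (τ - Real.log 2) * cre r hX0 τ + kapG p b (τ + Real.log 2) * cre r hX0 τ :=
    i1.add i2
  rw [integral_sub (i0.const_mul _) (i12.const_mul _), integral_const_mul, integral_const_mul, integral_add i1 i2]
  have s1 : ∫ τ, kapG p b (τ - Real.log 2) * cre r hX0 τ = ∫ u, kapG p b u * cre r hX0 (u + Real.log 2) := by
    rw [← integral_add_right_eq_self (fun τ => kapG p b (τ - Real.log 2) * cre r hX0 τ) (Real.log 2)]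
    simp only [add_sub_cancel_right]
  have s2 : ∫ τ, kapG p b (τ + Real.log 2) * cre r hX0 τ = ∫ u, kapG p b u * cre r hX0 (u - Real.log 2) := by
    rw [← integral_sub_right_eq_self (fun τ => kapG p b (τ + Real.log 2) * cre r hX0 τ) (Real.log 2)]
    simp only [sub_add_cancel]
  rw [s1, s2, integral_kapG_mul hb (fun u => cre r hX0 u) hcc,
    integral_kapG_mul hb (fun u => cre r hX0 (u + Real.log 2)) (hcc.comp (continuous_id.add continuous_const)),
    integral_kapG_mul hb (fun u => cre r hX0 (u - Real.log 2)) (hcc.comp (continuous_id.sub continuous_const))]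
  have hk : Continuous fun u => LQ.ev (kappaL p b) u := LQ.continuous_ev _
  have hI : ∀ f : ℝ → ℝ, Continuous f → IntervalIntegrable (fun u => LQ.ev (kappaL p b) u * f u) volume 0 (2 * b) :=
    fun f hf => (hk.mul hf).intervalIntegrable _ _
  have c1 : Continuous fun u => cre r hX0 u + cre r hX0 (-u) := hcc.add (hcc.comp continuous_neg)
  have c2 : Continuous fun u => cre r hX0 (u + Real.log 2) + cre r hX0 (-u + Real.log 2) :=
    (hcc.comp (continuous_id.add continuous_const)).add (hcc.comp ((continuous_neg).add continuous_const))
  have c3 : Continuous fun u => cre r hX0 (u - Real.log 2) + cre r hX0 (-u - Real.log 2) :=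
    (hcc.comp (continuous_id.sub continuous_const)).add (hcc.comp ((continuous_neg).sub continuous_const))
  rw [← intervalIntegral.integral_add (hI _ c2) (hI _ c3), ← intervalIntegral.integral_const_mul,
    ← intervalIntegral.integral_const_mul, ← intervalIntegral.integral_sub]
  · refine intervalIntegral.integral_congr fun u _ => ?_
    have e1 : cre r hX0 (-u) = cre r hX0 u := cre_neg r hX0 u
    have e2 : cre r hX0 (-u + Real.log 2) = cre r hX0 |u - Real.log 2| := by
      rcases le_or_gt (Real.log 2) u with h | h
      · rw [abs_of_nonneg (by linarith), show -u + Real.log 2 = -(u - Real.log 2) by ring, cre_neg]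
      · rw [abs_of_neg (by linarith)]; ring_nf
    have e3 : cre r hX0 (u - Real.log 2) = cre r hX0 |u - Real.log 2| := by
      rcases le_or_gt (Real.log 2) u with h | h
      · rw [abs_of_nonneg (by linarith)]
      · rw [abs_of_neg (by linarith), ← cre_neg r hX0 (u - Real.log 2)]
    have e4 : cre r hX0 (-u - Real.log 2) = cre r hX0 (u + Real.log 2) := by
      rw [show -u - Real.log 2 = -(u + Real.log 2) by ring, cre_neg]
    simp only [e1, e2, e3, e4]
    ring
  · exact ((hI _ c1).const_mul _)
  · exact (((hI _ c2).add (hI _ c3)).const_mul _)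

/-- **`B` with the closed form inserted**: if `2·e^{2b} ≤ X` (so that `e^s ≤ X` for every shift `s ≤ 2b + log 2` that occurs),
`B = ∫_0^{2b} κ(u)(3·cfun(u) − 2e^{−L/2}(cfun(u+L) + cfun(|u−L|))) du` (`0 ≤ b`). [folklore] -/
theorem re_soninTraceForm_eq_fold_cfun (hb : 0 ≤ b) (hX0 : 0 ≤ X) (hX : 2 * Real.exp (2 * b) ≤ X) :
    (soninTraceForm (twistKernel 2 (weilConv (polyWitness p b) (weilReflect (polyWitness p b))))
        (polyEta r hX0 : ℝ → ℂ)).re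
      = ∫ u in (0 : ℝ)..(2 * b), LQ.ev (kappaL p b) u *
          (3 * cfun r X u - 2 * Real.exp (-(Real.log 2 / 2)) * (cfun r X (u + Real.log 2) + cfun r X |u - Real.log 2|)) := by
  have hb' : (0 : ℝ) ≤ 2 * b := by exact_mod_cast (by linarith : (0 : ℚ) ≤ 2 * b)
  have hL : 0 < Real.log 2 := Real.log_pos (by norm_num)
  have hmax : Real.exp (2 * b + Real.log 2) ≤ X := by
    rw [Real.exp_add, Real.exp_log (by norm_num : (0 : ℝ) < 2)]; linarith
  have hcf : ∀ {s : ℝ}, 0 ≤ s → s ≤ 2 * b + Real.log 2 → cre r hX0 s = cfun r X s := fun hs0 hs =>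
    cre_eq_cfun r hX0 hs0 ((Real.exp_le_exp.2 hs).trans hmax)
  rw [re_soninTraceForm_eq_fold r hb hX0]
  refine intervalIntegral.integral_congr fun u hu => ?_
  rw [uIcc_of_le hb'] at hu
  have h1 : cre r hX0 u = cfun r X u := hcf hu.1 (by linarith [hu.2])
  have h2 : cre r hX0 (u + Real.log 2) = cfun r X (u + Real.log 2) := hcf (by linarith [hu.1]) (by linarith [hu.2])
  have h3 : cre r hX0 |u - Real.log 2| = cfun r X |u - Real.log 2| :=
    hcf (abs_nonneg _) ((abs_sub _ _).trans (by rw [abs_of_nonneg hu.1, abs_of_pos hL]; linarith [hu.2, hu.1]))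
  simp only [h1, h2, h3]

end Fold

end Summit.RiemannHypothesis.RiemannHypothesis.SoninPoly

end
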